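import Literature.AnabelianGeometry.EtaleTheta.TemperedFrobenioidToy
import Literature.AlgebraicGeometry.Frobenioids.PiNatMonoid
import Literature.AlgebraicGeometry.Frobenioids.ModelFrobenioid
import Mathlib.CategoryTheory.WithTerminal.Basic
import Mathlib.CategoryTheory.SingleObj
import HarnessLib

/-!
# [EtTh] Def. 3.3 (iii) / 3.6 (i) toy data over a GALOIS DOUBLE COVER whose divisor pull-back is a SHEAR
# (part 1 of the `hDSpull` non-derivability certificate for GAP G-w5d063-1; part 2: `TemperedFrobenioidToyShear.lean`)

S. Mochizuki, *The étale theta function …*, Publ. RIMS **45** (2009) [MochizukiEtTh2009], §3 Def. 3.3 (iii) (PDF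
p.73), Def. 3.6 (i) pp.76–77 [cite: MochizukiEtTh2009, Def 3.3 p.73]; S. Mochizuki, *The geometry of Frobenioids I*
(2008) [MochizukiFrdI2008], §0 p.14 (FSM-morphisms), Def. 1.1 (ii) p.19 (monoids on a category).

abc-iut cell, layer L2; seat abc-iut-L2-t3 (gen 6), OWNER lineage of `DivisorMonoids` / `RealifiedDivisorMonoids` /
`TemperedFrobenioid`.  CLASS (b) toy data (pattern of abc-iut-f-015's `TemperedFrobenioidToyTwoPrimes.lean`, whose
`Φ₀ = ℤ²_{≥0}`, `B₀ = Φ₀^gp`, `Div = id`, `ℝ·Φ₀^cnst = {g | g₀ = 0}` shape is re-used over a NEW base with a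
non-trivial covering):
* `ShearToy.Base := WithTerminal (SingleObj (ℤ/2))` — a Galois double cover `Y′ → Y` (`Aut(Y′/Y) = ℤ/2`, `Y` terminal);
  `σ ≫ cov = cov` for the deck transformation `σ ≠ 1`, so the covering map `cov : Y′ ⟶ Y` is NOT a monomorphism,
  hence NOT an FSM-morphism (`not_mono_cov`, `not_isFSM_cov`) — as for a genuine covering in `B^temp(Π)⁰`, where
  monomorphisms of connected objects are isomorphisms, clause (b) of [FrdI] Def. 1.1 (ii) («FSM-morphisms pull back
  to bijections») puts no condition on its pull-back;
* `ShearToy.Φ₀`: `Φ₀(Y) = Φ₀(Y′) = ℤ²_{≥0} = ⟨e₀, e₁⟩` (abc-iut-L1's `PiNat`); deck transformations pull back by the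
  identity, the cover by the **SHEAR** `shear : e₀ ↦ e₀ + e₁`, `e₁ ↦ e₁` (injective, not surjective; the coordinate
  character `χ₀ : f ↦ f₀` is invariant);
* `ShearToy.divisorMonoids` (Def. 3.3 (iii): `B₀ = Φ₀^gp`, `div₀ = id`, `F₀ = 1`, nothing cuspidal) and
  `ShearToy.realified` (Def. 3.6 (i): `Λ = ℤ`, `Φ₀^ℝ := Φ₀`, `B₀^Λ = B₀`, `F₀^Λ = ℝ·Φ₀^cnst := Ker ψ₀ = {g | g₀ = 0}` —
  shear-stable and root-closed, as the typed fields demand) over the trivial monoid vocabulary `Toy.monoidVocab`;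
  `ShearToy.bsFldEquiv`: `{f | f₀ = 0} = ℤ_{≥0}·e₁ ≅ ℤ_{≥0}`.
HONEST FRAMING: a combinatorial toy over OUR typed interfaces (trivial monoid vocabulary; one non-trivial covering;
not a curve); nothing here bears on the disputed [IUTchIII] Cor. 3.12; no side taken; typed ≠ proved.
-/

noncomputable section

namespace Literature.AnabelianGeometry.EtaleTheta

open CategoryTheory Opposite Function Literature.AlgebraicGeometry.Frobenioids

namespace ShearToy

/-! ### §1 The base: a Galois double cover `Y′ → Y` (`D = D₀ = WithTerminal (SingleObj (ℤ/2))`) -/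

/-- The deck-transformation group `ℤ/2` of the cover. [cite: MochizukiEtTh2009, Def 3.3 p.73] -/
abbrev G : Type := Multiplicative (ZMod 2)

/-- The base category: the one-object groupoid of `ℤ/2` (the cover `Y′` with its deck transformations) with a
terminal object (the curve `Y`) adjoined. [cite: MochizukiEtTh2009, Def 3.3 p.73] -/
abbrev Base : Type := WithTerminal (SingleObj G)

/-- The cover `Y′`. [cite: MochizukiEtTh2009, Def 3.3 p.73] -/
abbrev Y' : Base := WithTerminal.of (SingleObj.star G)

/-- The curve `Y` (terminal). [cite: MochizukiEtTh2009, Def 3.3 p.73] -/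
abbrev Y : Base := WithTerminal.star

/-- The covering map `Y′ → Y`. [cite: MochizukiEtTh2009, Def 3.3 p.73] -/
def cov : Y' ⟶ Y := PUnit.unit

/-- The non-trivial deck transformation `σ` of `Y′`. [cite: MochizukiEtTh2009, Def 3.3 p.73] -/
def σ : Y' ⟶ Y' := (Multiplicative.ofAdd (1 : ZMod 2) : G)

/-- `σ ≠ 1`. [cite: MochizukiEtTh2009, Def 3.3 p.73] -/
theorem σ_ne_id : σ ≠ 𝟙 Y' := by
  intro h
  have h' : (Multiplicative.ofAdd (1 : ZMod 2) : G) = Multiplicative.ofAdd (0 : ZMod 2) := h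
  exact absurd (Multiplicative.ofAdd.injective h') (by decide)

/-- `σ ≫ cov = cov`: the cover is invariant under its deck transformation.
[cite: MochizukiEtTh2009, Def 3.3 p.73] -/
theorem σ_comp_cov : σ ≫ cov = cov := rfl

/-- Hence `cov` is NOT a monomorphism. [cite: MochizukiFrdI2008, §0 p.14] -/
theorem not_mono_cov : ¬ Mono cov := by
  intro h
  apply σ_ne_id
  exact h.right_cancellation σ (𝟙 Y') (by rw [σ_comp_cov, Category.id_comp])

/-- Hence `cov` is NOT an FSM-morphism ([FrdI] §0: FSM = fiberwise-surjective monomorphism), so clause (b) of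
[FrdI] Def. 1.1 (ii) puts no condition on its pull-back. [cite: MochizukiFrdI2008, Def. 1.1(ii) p.19] -/
theorem not_isFSM_cov : ¬ IsFSM cov := fun h => not_mono_cov h.2

/-- Every morphism `Y′ ⟶ Y` is `cov`. [cite: MochizukiEtTh2009, Def 3.3 p.73] -/
theorem hom_Y'_Y_eq (f : Y' ⟶ Y) : f = cov := rfl

/-! ### §2 The monoid `ℤ²_{≥0} = ⟨e₀, e₁⟩`, the shear, the coordinate character `χ₀` -/

/-- `Φ₀(Y) = Φ₀(Y′) = ℤ²_{≥0}`. [cite: MochizukiEtTh2009, Def 3.3 p.73] -/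
abbrev M : Type := Multiplicative (Fin 2 → ℕ)

/-- The two primes `e₀, e₁`. [cite: MochizukiEtTh2009, Def 3.3 p.73] -/
def e (j : Fin 2) : M := PiNat.single j 1

/-- `e_j ≠ 0`. [cite: MochizukiEtTh2009, Def 3.3 p.73] -/
theorem e_ne_one (j : Fin 2) : e j ≠ 1 := fun h => by
  have := congrArg (fun f : M => PiNat.coeff f j) h
  simp [e] at this

/-- **The shear** `f ↦ f + f₀·e₁` (`e₀ ↦ e₀ + e₁`, `e₁ ↦ e₁`): the pull-back of log-divisors along the cover in
this toy. [cite: MochizukiEtTh2009, Def 3.3 p.73] -/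
def shear : M →* M where
  toFun f := f * PiNat.single 1 (PiNat.coeff f 0)
  map_one' := by rw [PiNat.coeff_one, PiNat.single_zero, mul_one]
  map_mul' f g := by rw [PiNat.coeff_mul, ← PiNat.single_mul_single, mul_mul_mul_comm]

/-- The shear fixes the `0`-th exponent. [cite: MochizukiEtTh2009, Def 3.3 p.73] -/
@[simp] theorem coeff_shear_zero (f : M) : PiNat.coeff (shear f) 0 = PiNat.coeff f 0 := by
  change PiNat.coeff (f * PiNat.single 1 (PiNat.coeff f 0)) 0 = _
  rw [PiNat.coeff_mul, PiNat.coeff_single_of_ne (show (0 : Fin 2) ≠ 1 by decide), add_zero]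

/-- The shear adds the `0`-th exponent to the `1`-st. [cite: MochizukiEtTh2009, Def 3.3 p.73] -/
@[simp] theorem coeff_shear_one (f : M) : PiNat.coeff (shear f) 1 = PiNat.coeff f 1 + PiNat.coeff f 0 := by
  change PiNat.coeff (f * PiNat.single 1 (PiNat.coeff f 0)) 1 = _
  rw [PiNat.coeff_mul, PiNat.coeff_single_same]

/-- `shear e₀ = e₀ + e₁`. [cite: MochizukiEtTh2009, Def 3.3 p.73] -/
theorem shear_e_zero : shear (e 0) = e 0 * e 1 := by
  change e 0 * PiNat.single 1 (PiNat.coeff (e 0) 0) = _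
  rw [e, PiNat.coeff_single_same]
  rfl

/-- `shear e₁ = e₁`. [cite: MochizukiEtTh2009, Def 3.3 p.73] -/
theorem shear_e_one : shear (e 1) = e 1 := by
  change e 1 * PiNat.single 1 (PiNat.coeff (e 1) 0) = _
  rw [e, PiNat.coeff_single_of_ne (show (0 : Fin 2) ≠ 1 by decide), PiNat.single_zero, mul_one]

/-- The shear is injective. [cite: MochizukiFrdI2008, Def. 1.1(ii) p.19] -/
theorem shear_injective : Injective shear := by
  intro f g h
  have h0 : PiNat.coeff f 0 = PiNat.coeff g 0 := by rw [← coeff_shear_zero f, h, coeff_shear_zero]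
  have h1 : PiNat.coeff f 1 = PiNat.coeff g 1 := by
    have := congrArg (fun x : M => PiNat.coeff x 1) h
    simp only [coeff_shear_one, h0] at this
    omega
  refine PiNat.ext fun j => ?_
  fin_cases j
  · exact h0
  · exact h1

/-- The `0`-th coordinate character `f ↦ f₀`, valued in `ℤ`. [cite: MochizukiEtTh2009, Def 3.6 p.76] -/
def χ₀ : M →* Multiplicative ℤ :=
  ((Nat.castAddMonoidHom ℤ).comp (Pi.evalAddMonoidHom (fun _ : Fin 2 => ℕ) 0)).toMultiplicative

/-- `χ₀` on a coordinate vector. [cite: MochizukiEtTh2009, Def 3.6 p.76] -/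
theorem χ₀_apply (f : M) : χ₀ f = Multiplicative.ofAdd ((PiNat.coeff f 0 : ℕ) : ℤ) := rfl

/-- `χ₀` is shear-invariant. [cite: MochizukiEtTh2009, Def 3.6 p.76] -/
theorem χ₀_shear (f : M) : χ₀ (shear f) = χ₀ f := by
  rw [χ₀_apply, χ₀_apply, coeff_shear_zero]

/-- `χ₀(e₁) = 0`. [cite: MochizukiEtTh2009, Def 3.6 p.76] -/
theorem χ₀_e_one : χ₀ (e 1) = 1 := by
  rw [χ₀_apply, e, PiNat.coeff_single_of_ne (show (0 : Fin 2) ≠ 1 by decide)]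
  rfl

/-- The coordinate character on the groupification `(ℤ²_{≥0})^gp → ℤ`. [cite: MochizukiEtTh2009, Def 3.6 p.76] -/
def ψ₀ : Algebra.GrothendieckGroup M →* Multiplicative ℤ := Algebra.GrothendieckGroup.lift χ₀

/-- `ψ₀` extends `χ₀`. [cite: MochizukiEtTh2009, Def 3.6 p.76] -/
theorem ψ₀_of (f : M) : ψ₀ (Algebra.GrothendieckGroup.of f) = χ₀ f := by
  have h := Algebra.GrothendieckGroup.lift.symm_apply_apply χ₀
  rw [Algebra.GrothendieckGroup.lift_symm_apply] at h
  exact DFunLike.congr_fun h f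

/-! ### §3 `Φ₀` on the base: identity along deck transformations, SHEAR along the cover -/

/-- The pull-back of log-divisors along a morphism of the base: identity on `Y′ ⟶ Y′` and `Y ⟶ Y`, the shear on the
cover `Y′ ⟶ Y`. [cite: MochizukiEtTh2009, Def 3.3 p.73] -/
def pullHom : ∀ {P Q : Base}, (P ⟶ Q) → (M →* M)
  | .of _, .of _, _ => MonoidHom.id M
  | .of _, .star, _ => shear
  | .star, .star, _ => MonoidHom.id M
  | .star, .of _, f => (WithTerminal.false_of_from_star f).elim

/-- `pullHom` along the cover is the shear. [cite: MochizukiEtTh2009, Def 3.3 p.73] -/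
@[simp] theorem pullHom_cov : pullHom cov = shear := rfl

/-- `pullHom (𝟙 _) = id`. [cite: MochizukiEtTh2009, Def 3.3 p.73] -/
theorem pullHom_id : ∀ P : Base, pullHom (𝟙 P) = MonoidHom.id M
  | .of _ => rfl
  | .star => rfl

/-- `pullHom` is contravariantly functorial. [cite: MochizukiEtTh2009, Def 3.3 p.73] -/
theorem pullHom_comp :
    ∀ {P Q R : Base} (a : P ⟶ Q) (b : Q ⟶ R), pullHom (a ≫ b) = (pullHom a).comp (pullHom b)
  | .of _, .of _, .of _, _, _ => rfl
  | .of _, .of _, .star, _, _ => rfl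
  | .of _, .star, .star, _, _ => rfl
  | .star, .star, .star, _, _ => rfl
  | .star, .of _, _, a, _ => (WithTerminal.false_of_from_star a).elim
  | .of _, .star, .of _, _, b => (WithTerminal.false_of_from_star b).elim
  | .star, .star, .of _, _, b => (WithTerminal.false_of_from_star b).elim

/-- Every `pullHom` is the identity or the shear; `χ₀` is invariant. [cite: MochizukiEtTh2009, Def 3.6 p.76] -/
theorem χ₀_pullHom : ∀ {P Q : Base} (a : P ⟶ Q) (f : M), χ₀ (pullHom a f) = χ₀ f
  | .of _, .of _, _, _ => rfl
  | .of _, .star, _, f => χ₀_shear f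
  | .star, .star, _, _ => rfl
  | .star, .of _, a, _ => (WithTerminal.false_of_from_star a).elim

/-- Every `pullHom` is injective. [cite: MochizukiFrdI2008, Def. 1.1(ii) p.19] -/
theorem pullHom_injective : ∀ {P Q : Base} (a : P ⟶ Q), Injective (pullHom a)
  | .of _, .of _, _ => injective_id
  | .of _, .star, _ => shear_injective
  | .star, .star, _ => injective_id
  | .star, .of _, a => (WithTerminal.false_of_from_star a).elim

/-- **`Φ₀ : D₀ → Mon`** of the toy. [cite: MochizukiEtTh2009, Def 3.3 p.73] -/
def Φ₀ : Baseᵒᵖ ⥤ CommMonCat.{0} where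
  obj _ := CommMonCat.of M
  map f := CommMonCat.ofHom (pullHom f.unop)
  map_id P := by
    apply CommMonCat.hom_ext
    rw [CommMonCat.hom_ofHom, CommMonCat.hom_id, unop_id, pullHom_id]
  map_comp f g := by
    apply CommMonCat.hom_ext
    rw [CommMonCat.hom_ofHom, CommMonCat.hom_comp, CommMonCat.hom_ofHom, CommMonCat.hom_ofHom, unop_comp,
      pullHom_comp]

/-- Values of `Φ₀` on morphisms. [cite: MochizukiEtTh2009, Def 3.3 p.73] -/
@[simp] theorem Φ₀_map_hom {P Q : Baseᵒᵖ} (f : P ⟶ Q) : (Φ₀.map f).hom = pullHom f.unop := rfl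

/-- `ψ₀` is invariant under every pull-back on groupifications. [cite: MochizukiEtTh2009, Def 3.6 p.76] -/
theorem ψ₀_gpMap_pullHom {P Q : Base} (a : P ⟶ Q) (x : Algebra.GrothendieckGroup M) :
    ψ₀ (gpMap (pullHom a) x) = ψ₀ x := by
  have h : ψ₀.comp (gpMap (pullHom a)) = ψ₀ :=
    MonGp.hom_ext fun f => by rw [MonoidHom.comp_apply, gpMap_of, ψ₀_of, ψ₀_of, χ₀_pullHom]
  exact DFunLike.congr_fun h x

/-! ### §4 The typed data: Def. 3.3 (iii) and Def. 3.6 (i) (`ℝ·Φ₀^cnst := {g | g₀ = 0}`) -/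

/-- Def. 3.3 (iii) data: `Φ₀ = ℤ²_{≥0}` with the shear, `B₀ = Φ₀^gp`, `div₀ = id`, `F₀ = 1`, nothing cuspidal.
[cite: MochizukiEtTh2009, Def 3.3 p.73] -/
def divisorMonoids : DivisorMonoids.{0, 0, 0} Base where
  Φ₀ := Φ₀
  B₀ := monoidGp Φ₀
  isUnit_B₀ _ b := by
    change IsUnit (M := Algebra.GrothendieckGroup M) b
    exact Group.isUnit _
  div₀ _ := MonoidHom.id _
  div₀_natural _ _ := rfl
  F₀ _ := ⊥
  F₀_map _ _ hb := by
    rw [Submonoid.mem_bot] at hb ⊢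
    rw [hb, map_one]
  ncsp₀ _ := ⊤
  csp₀ _ := ⊥
  ncsp₀_map _ _ _ := trivial
  csp₀_map _ x hx := by
    rw [Submonoid.mem_bot] at hx ⊢
    rw [hx, map_one]
  existsUnique_ncsp_csp _ x := by
    refine ⟨(⟨x, trivial⟩, ⟨1, Submonoid.mem_bot.mpr rfl⟩), mul_one x, ?_⟩
    rintro ⟨a, c⟩ h
    have hc : c.1 = 1 := Submonoid.mem_bot.mp c.2
    have ha : a.1 = x := by
      have h' : a.1 * c.1 = x := h
      rwa [hc, mul_one] at h'
    exact Prod.ext (Subtype.ext ha) (Subtype.ext hc)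

/-- Def. 3.6 (i) data (`Λ = ℤ`, `Φ₀^ℝ = Φ₀`, `B₀^Λ = B₀ = Φ₀^gp`, `Div = id`), constant locus
`ℝ·Φ₀^cnst := Ker(ψ₀) = {g | g₀ = 0}` = `F₀^Λ` — shear-stable and root-closed, as the typed fields demand.
[cite: MochizukiEtTh2009, Def 3.6 p.76] -/
def realified : RealifiedDivisorMonoids (D₀ := Base) Toy.monoidVocab where
  toDivisorMonoids := divisorMonoids
  Λ := MonoidType.Z
  ΦR := Φ₀
  toR _ := MonoidHom.id _
  toR_natural _ _ := rfl
  isRealification _ := trivial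
  BΛ := monoidGp Φ₀
  isUnit_BΛ _ b := by
    change IsUnit (M := Algebra.GrothendieckGroup M) b
    exact Group.isUnit _
  divΛ _ := MonoidHom.id _
  divΛ_natural _ _ := rfl
  FΛ _ := ψ₀.ker.toSubmonoid
  FΛ_map f b hb := by
    change ψ₀ (gpMap (pullHom f.unop) b) = 1
    rw [ψ₀_gpMap_pullHom]
    exact hb
  cnstR _ := ψ₀.ker
  cnstR_map f x hx := by
    change ψ₀ (gpMap (pullHom f.unop) x) = 1
    rw [ψ₀_gpMap_pullHom]
    exact hx
  divΛ_mem_cnstR _ _ hb := hb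
  cnstR_root _ g n hg := by
    have hg' : ψ₀ g ^ (n : ℕ) = 1 := by rw [← map_pow]; exact hg
    have h : (n : ℕ) • Multiplicative.toAdd (ψ₀ g) = 0 := by
      have := congrArg Multiplicative.toAdd hg'
      rwa [toAdd_pow, toAdd_one] at this
    change ψ₀ g = 1
    rcases smul_eq_zero.mp h with h | h
    · exact absurd h n.ne_zero
    · exact congrArg Multiplicative.ofAdd h
  cnst_le_cnstR _ b hb := by
    have hb' : b = 1 := Submonoid.mem_bot.mp hb
    subst hb'
    change ψ₀ (gpMap (MonoidHom.id M) (MonoidHom.id _ 1)) = 1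
    rw [map_one, map_one, map_one]
  ncspR _ := ⊤
  cspR _ := ⊥
  toR_ncsp _ _ _ := trivial
  toR_csp _ _ hx := hx

/-- The base-field-theoretic submonoid `{f | f₀ = 0} = ℤ_{≥0}·e₁ ≅ ℤ_{≥0}` (the map `f ↦ f₁`).
[cite: MochizukiEtTh2009, Def 3.6 p.77] -/
def bsFldEquiv :
    ↥((⊤ : Submonoid M) ⊓ (ψ₀.ker).toSubmonoid.comap Algebra.GrothendieckGroup.of) ≃* Multiplicative ℕ where
  toFun f := Multiplicative.ofAdd (PiNat.coeff f.1 1)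
  invFun k := ⟨PiNat.single 1 (Multiplicative.toAdd k), Submonoid.mem_top _, by
    change Algebra.GrothendieckGroup.of (PiNat.single 1 (Multiplicative.toAdd k) : M) ∈ ψ₀.ker
    rw [MonoidHom.mem_ker, ψ₀_of, χ₀_apply, PiNat.coeff_single_of_ne (show (0 : Fin 2) ≠ 1 by decide)]
    rfl⟩
  left_inv f := by
    obtain ⟨f, -, hf⟩ := f
    apply Subtype.ext
    change (PiNat.single 1 (PiNat.coeff f 1) : M) = f
    have hf' : ψ₀ (Algebra.GrothendieckGroup.of f) = 1 := hf
    rw [ψ₀_of, χ₀_apply] at hf'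
    have h0 : PiNat.coeff f 0 = 0 := by
      have := Multiplicative.ofAdd.injective hf'
      exact_mod_cast this
    refine (PiNat.eq_single_of_coeff_eq_zero fun i hi => ?_).symm
    fin_cases i
    · exact h0
    · exact absurd rfl hi
  right_inv k := by simp
  map_mul' f g := by
    change Multiplicative.ofAdd (PiNat.coeff (f.1 * g.1) 1) = _
    rw [PiNat.coeff_mul, ofAdd_add]

end ShearToy

end Literature.AnabelianGeometry.EtaleTheta

end
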